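import Summits.NavierStokesRegularity.NavierStokesRegularity.Theorems.SymmetricLiouville.Negative.LoadBearing
import Literature.Analysis.UnboundedOperators.HeatExtensionDecay
import Literature.Analysis.FluidPDE.ChaeWolfRemovingDSSBounds

/-!
# Crux `SymmetricLiouville` (stmt-NavierStokesRegularity-4053), negative side, cycle 2:
the gap theorem — the small-constant regime of `𝒜_C` is empty

Negative-side (cdisprove, D-0016) support lemma extracted from
`Cruxes/SymmetricLiouville/Disproof.lean` (v7, gen-2 seat, §(d)) of route `SymmetryModuliCount`,
about the class `InClass C` (= `𝒜_C`) and the conclusion `VanishesOnPast` of `LoadBearing.lean`.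

* `exists_eps_small_vanishes` — there is an absolute `ε₀ > 0` such that every element of `𝒜_C`
  (smooth, divergence free, KNSS/Oseen-mild between all `s < t < 0`, Type-I in time with ANY
  constant `C`) whose scale-invariant size obeys `√(−t)‖u(t,x)‖ ≤ ε₀` throughout vanishes
  identically. Proof as in Chae–Wolf 2017, Step 1 (tree: `ChaeWolf.exists_eps_typeI_small_eq_zero`,
  there for classical solutions with the space–time bound; here mildness is a clause of the class):
  the Oseen identity from `4t` to `t`, the sup-norm heat contraction and Koch–Tataru's kernel bound
  (14) give `B ≤ B/2 + K₀B²` for `B = sup √(−t)‖u‖`, so `B = 0` once `K₀B ≤ 1/4`.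
* `exists_eps_vanishes_of_le` — hence the crux, indeed the route target `X`, holds with NO symmetry
  for every `C ≤ ε₀`: a counterexample to `SymmetricLiouville` necessarily has `C > ε₀` and
  scale-invariant size `> ε₀` somewhere (disproof-side reading: the perturbative regime is empty;
  prover-side reading: the "small at `−∞` ⇒ `0`" stub is this inequality run on `(−∞, T]` plus
  `oseenMild_bounded_unique`).

No route statement is changed (`--supports`).
-/

noncomputable section

namespace Summit.NavierStokesRegularity.NavierStokesRegularity.Theorems.SymmetricLiouville.Negative

open Literature.Analysis.FluidPDE MeasureTheory Set Function
open scoped RealInnerProductSpace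

local notation "E3" => EuclideanSpace ℝ (Fin 3)

/-- **Gap theorem for `𝒜_C` (perturbative regime; no symmetry).** There is an absolute `ε₀ > 0`
such that every element of `𝒜_C` (any `C`) with `√(−t)‖u(t,x)‖ ≤ ε₀` for all `t < 0` and `x`
vanishes identically. Proof as in Chae–Wolf 2017, Step 1 (tree:
`ChaeWolf.exists_eps_typeI_small_eq_zero`, stated there for classical solutions with the SPACE–TIME
bound; here mildness is a hypothesis of the class, so neither KNSS Thm 6.1 nor spatial decay is
needed): the Oseen identity from `4t` to `t`, the heat contraction and Koch–Tataru's kernel bound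
(14) (`exists_norm_oseenKernel_le`, `ChaeWolf.norm_integral_oseenKernel_le`) give
`B ≤ B/2 + K₀B²` for `B = sup √(−t)‖u‖`, hence `B = 0` once `K₀B ≤ 1/4`.
CONSEQUENCES: (i) the crux AND the route target `X` hold outright in the regime
`sup √(−t)‖u‖ ≤ ε₀`, in particular for `C ≤ ε₀` (`exists_eps_vanishes_of_le`); (ii) every
counterexample to the crux has scale-invariant size `> ε₀` at some point — with
`vanishes_of_duhamel_zero` this pins it in the genuinely nonlinear, non-perturbative regime;
(iii) the ideators' stub "small at `−∞` ⇒ `0`" is this lemma run on `(−∞, T]` plus forward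
uniqueness of bounded Oseen-mild solutions (tree: `oseenMild_bounded_unique`). -/
theorem exists_eps_small_vanishes :
    ∃ ε₀ : ℝ, 0 < ε₀ ∧ ∀ (C : ℝ) (u : ℝ → E3 → E3), InClass C u →
      (∀ t < 0, ∀ x, Real.sqrt (-t) * ‖u t x‖ ≤ ε₀) → VanishesOnPast u := by
  obtain ⟨K, hK, hKb⟩ := exists_norm_oseenKernel_le (E := E3)
  set M₀ : ℝ := ∫ w : E3, (1 + ‖w‖ ^ 2) ^ (-(2 : ℝ)) with hM₀
  have hM₀0 : 0 ≤ M₀ := integral_nonneg fun w => Real.rpow_nonneg (by positivity) _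
  set K₀ : ℝ := 4 * K * M₀ with hK₀
  have hK₀0 : 0 ≤ K₀ := by positivity
  set ε : ℝ := 1 / (4 * K₀ + 4) with hε
  have hε0 : 0 < ε := by positivity
  have hKε : K₀ * ε ≤ 1 / 4 := by
    rw [hε, mul_one_div, div_le_iff₀ (by positivity)]
    linarith
  refine ⟨ε, hε0, ?_⟩
  intro C u hu hsmall
  have finrank_R3_real : ((Module.finrank ℝ E3 : ℕ) : ℝ) = 3 := by simp
  have hK' : ∀ {τ : ℝ}, 0 < τ → ∀ z a b : E3,
      ‖oseenKernel τ z a b‖ ≤ K * (τ + ‖z‖ ^ 2) ^ (-(2 : ℝ)) * ‖a‖ * ‖b‖ := by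
    intro τ hτ z a b
    have h := hKb hτ z a b
    rw [finrank_R3_real, show (-(((3 : ℝ) + 1) / 2)) = -(2 : ℝ) by norm_num] at h
    exact h
  set S : Set ℝ := {r | ∃ t : ℝ, t < 0 ∧ ∃ x : E3, r = Real.sqrt (-t) * ‖u t x‖} with hS
  have hSb : BddAbove S := ⟨ε, by rintro r ⟨t, ht, x, rfl⟩; exact hsmall t ht x⟩
  have hSn : S.Nonempty := ⟨_, -1, by norm_num, 0, rfl⟩
  set B : ℝ := sSup S with hB
  have hqB : ∀ t < 0, ∀ x, Real.sqrt (-t) * ‖u t x‖ ≤ B := fun t ht x =>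
    le_csSup hSb ⟨t, ht, x, rfl⟩
  have hBε : B ≤ ε := csSup_le hSn (by rintro r ⟨t, ht, x, rfl⟩; exact hsmall t ht x)
  have hB0 : 0 ≤ B := le_trans (by positivity) (hqB (-1) (by norm_num) 0)
  have hptw : ∀ σ < 0, ∀ y, ‖u σ y‖ ≤ B / Real.sqrt (-σ) := by
    intro σ hσ y
    have hs : 0 < Real.sqrt (-σ) := Real.sqrt_pos.2 (by linarith)
    rw [le_div_iff₀ hs, mul_comm]
    exact hqB σ hσ y
  -- the key estimate `√(-t) ‖u(t, x)‖ ≤ B/2 + K₀ B²`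
  have hkey : ∀ t < 0, ∀ x, Real.sqrt (-t) * ‖u t x‖ ≤ B / 2 + K₀ * B ^ 2 := by
    intro t ht x
    set r : ℝ := Real.sqrt (-t) with hr
    have hr0 : 0 < r := Real.sqrt_pos.2 (by linarith)
    have hr2 : r ^ 2 = -t := Real.sq_sqrt (by linarith)
    -- the Oseen identity of the class between `4t` and `t`
    have hmild : u t x =
        Literature.Analysis.UnboundedOperators.heatExtension (u (4 * t)) (t - 4 * t) x -
          oseenDuhamel 1 (4 * t) u u t x := by
      have h1 := hu.2.2.1 (4 * t) t (by linarith) ht x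
      rw [heatFlow_of_pos _ (by linarith)] at h1
      simpa only [oseenDuhamel, one_mul] using h1
    -- the caloric term
    have hheat :
        ‖Literature.Analysis.UnboundedOperators.heatExtension (u (4 * t)) (t - 4 * t) x‖ ≤
          B / (2 * r) := by
      have hb : ∀ z, ‖u (4 * t) z‖ ≤ B / (2 * r) := by
        intro z
        have := hptw (4 * t) (by linarith) z
        rwa [ChaeWolf.sqrt_neg_four_mul, ← hr] at this
      exact Literature.Analysis.UnboundedOperators.norm_heatExtension_le_of_bound hb (by linarith) x
    -- the Duhamel term
    have hduh : ‖oseenDuhamel 1 (4 * t) u u t x‖ ≤ K₀ * B ^ 2 / r := by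
      rw [oseenDuhamel_apply]
      have hG : IntegrableOn (fun σ : ℝ => K * M₀ * (B ^ 2 / r ^ 2) * (t - σ) ^ (-(1 / 2 : ℝ)))
          (Set.Ioo (4 * t) t) := (ChaeWolf.integrableOn_rpow_sub ht).const_mul _
      have hpt : ∀ᵐ σ ∂(volume.restrict (Set.Ioo (4 * t) t)),
          ‖∫ y, oseenKernel (1 * (t - σ)) (x - y) (u σ y) (u σ y)‖ ≤
            K * M₀ * (B ^ 2 / r ^ 2) * (t - σ) ^ (-(1 / 2 : ℝ)) := by
        refine ae_restrict_of_forall_mem measurableSet_Ioo fun σ hσ => ?_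
        have hσ0 : σ < 0 := hσ.2.trans ht
        have hτ : 0 < 1 * (t - σ) := by linarith [hσ.2]
        have h1 := ChaeWolf.norm_integral_oseenKernel_le hK' hK.le hτ x (hptw σ hσ0)
        rw [one_mul] at h1 ⊢
        refine h1.trans ?_
        have hsq : (B / Real.sqrt (-σ)) ^ 2 = B ^ 2 / (-σ) := by
          rw [div_pow, Real.sq_sqrt (by linarith)]
        rw [hsq]
        have hw0 : 0 ≤ (t - σ) ^ (-(1 / 2 : ℝ)) := Real.rpow_nonneg (by linarith [hσ.2]) _
        have hfrac : B ^ 2 / (-σ) ≤ B ^ 2 / r ^ 2 := by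
          rw [hr2]
          exact div_le_div_of_nonneg_left (sq_nonneg B) (by linarith) (by linarith [hσ.2])
        calc K * M₀ * (t - σ) ^ (-(1 / 2 : ℝ)) * (B ^ 2 / -σ)
            ≤ K * M₀ * (t - σ) ^ (-(1 / 2 : ℝ)) * (B ^ 2 / r ^ 2) := by gcongr
          _ = K * M₀ * (B ^ 2 / r ^ 2) * (t - σ) ^ (-(1 / 2 : ℝ)) := by ring
      refine (norm_integral_le_of_norm_le hG hpt).trans ?_
      rw [MeasureTheory.integral_const_mul, ChaeWolf.integral_rpow_sub ht]
      have h3 := ChaeWolf.sqrt_neg_three_mul_le t ht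
      rw [← hr] at h3
      have hrr : r ^ 2 = r * r := sq r
      calc K * M₀ * (B ^ 2 / r ^ 2) * (2 * Real.sqrt (-(3 * t)))
          ≤ K * M₀ * (B ^ 2 / r ^ 2) * (2 * (2 * r)) := by gcongr
        _ = K₀ * B ^ 2 / r := by
            rw [hK₀, hrr]
            field_simp
            ring
    -- assemble
    have hnorm : ‖u t x‖ ≤ B / (2 * r) + K₀ * B ^ 2 / r := by
      rw [hmild]
      exact (norm_sub_le _ _).trans (add_le_add hheat hduh)
    calc r * ‖u t x‖ ≤ r * (B / (2 * r) + K₀ * B ^ 2 / r) := by gcongr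
      _ = B / 2 + K₀ * B ^ 2 := by field_simp
  -- bootstrap: `B ≤ B/2 + K₀ B²` and `B ≤ ε` force `B = 0`
  have hB1 : B ≤ B / 2 + K₀ * B ^ 2 :=
    csSup_le hSn (by rintro r ⟨t, ht, x, rfl⟩; exact hkey t ht x)
  have hB2 : K₀ * B ^ 2 ≤ B / 4 := by
    calc K₀ * B ^ 2 = (K₀ * B) * B := by ring
      _ ≤ (K₀ * ε) * B := by gcongr
      _ ≤ (1 / 4) * B := by gcongr
      _ = B / 4 := by ring
  have hB00 : B ≤ 0 := by linarith
  intro t ht x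
  have hst : 0 < Real.sqrt (-t) := Real.sqrt_pos.2 (by linarith)
  have h' : Real.sqrt (-t) * ‖u t x‖ ≤ 0 := (hqB t ht x).trans hB00
  have hn : ‖u t x‖ ≤ 0 := by
    by_contra hcon
    have hcon' : 0 < ‖u t x‖ := lt_of_not_ge hcon
    have : 0 < Real.sqrt (-t) * ‖u t x‖ := mul_pos hst hcon'
    linarith
  exact norm_le_zero_iff.1 hn

/-- **The small-`C` regime is empty of counterexamples**: the crux — indeed the route target `X`,
with no symmetry — holds for every `C ≤ ε₀` (`√(−t)‖u(t,x)‖ ≤ C`). Any counterexample lives at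
`C > ε₀`, an absolute constant (Koch–Tataru's kernel constant in dimension three). -/
theorem exists_eps_vanishes_of_le :
    ∃ ε₀ : ℝ, 0 < ε₀ ∧ ∀ (C : ℝ) (u : ℝ → E3 → E3), InClass C u → C ≤ ε₀ → VanishesOnPast u := by
  obtain ⟨ε₀, hε₀, h⟩ := exists_eps_small_vanishes
  refine ⟨ε₀, hε₀, fun C u hu hC => h C u hu fun t ht x => ?_⟩
  have hs : 0 < Real.sqrt (-t) := Real.sqrt_pos.2 (by linarith)
  calc Real.sqrt (-t) * ‖u t x‖ ≤ Real.sqrt (-t) * (C / Real.sqrt (-t)) := by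
        gcongr
        exact hu.2.2.2 t ht x
    _ = C := by field_simp
    _ ≤ ε₀ := hC


end Summit.NavierStokesRegularity.NavierStokesRegularity.Theorems.SymmetricLiouville.Negative

end
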